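import Summits.QuantumFields.YangMills.Theorems.SwapVirialDeficitBlowUpVirialFollowersShare
import HarnessLib

/-!
# Principal-sector window stiffness from the LEADERS' window inequality alone (followers absorbed)

The `z = 000` half of (TS) in ✓`swapGluedStiffness_of_twoSectorStiffness` reads `(9L⁴ − 3/2 + c)·Z₀ ≤ β·E₀` on a window; by ✓`virial_ring'` this is
`K_L(½⟪gnoW⟫ − β⟪R⟫) ≤ (1/2 − c)Z₀`.  Split `gnoW = W_L + W_F` and absorb the followers' share (✓`followersW_term_apriori`, `O(L^{14} log β/β)·Z₀`):

* §1 `leadersW_nonneg_le` (`0 ≤ W_L ≤ 12`), `measurable_leadersW`, `integrable_leadersW_fibre`, `fibre_gnoW_split`, `integrable_fibre_leadersW`,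
  ★ `weight_functional_split` (`⟪gnoW⟫_{z,b} = ⟪W_L⟫_{z,b} + ⟪W_F⟫_{z,b}`);
* §2 ★ `followers_window_arith` — on `L ≤ β^{1/56}`, `β ≥ max 1 (2C₀/c)²` (`C₀ = 13824·(18+2K)·5`): the followers' coefficient is `≤ c/2`;
* §3 ★★★ `principalStiffness_of_leadersWindow (hLW)` — from the LEADERS' WINDOW INEQUALITY (LW, inline, OPEN):
  `K_L·(½⟪W_L⟫_{0,β} − β⟪R⟫_{0,β}) ≤ (1/2 − c)·Z₀(β)` on `L₀ ≤ L ≤ β^a`, `β ≥ β₀`, conclude the principal window stiffness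
  `(9L⁴ − 3/2 + c/2)·Z₀(β) ≤ β·E₀(β)` on `L₀ ≤ L ≤ β^{min a 1/56}`, `β ≥ β₀'` (explicit).
So the principal sector of ⟨24197⟩ is reduced to a statement about the THREE LEADER LETTERS' Euler weight and the remainder only.

HONEST LABEL: a REDUCTION (proved); (LW) is the valley term + remainder and is OPEN (crux-level); the minus sector `001` is untouched; ⟨24197⟩ ∕ ⟨24194⟩ ∕ ⟨24497⟩
OPEN; own crux ⟨22884⟩ OPEN (blocked-on ⟨19935⟩); no crux, rung of record or summit is proved; the Yang–Mills mass gap is NOT proved; no summit is proved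
by a line.  THEOREMS ONLY (hypothesis inline; 0 `def`, 0 `sorry`), standard axioms.  Width seat ym-line-sfw-p2-w2 g57 (cell ym-idea-1, free hands),
`--supports stmt-QuantumFields-24197`.  References: [cite: tHooft1979]; [cite: Luscher1983, §2]; [cite: Griffiths1964]; [folklore].
-/

set_option autoImplicit false
set_option synthInstance.maxSize 1024

noncomputable section

open MeasureTheory Quaternion Set Filter Topology
open scoped Quaternion BigOperators
open Literature.MathematicalPhysics.QuantumLattice
open Literature.MathematicalPhysics.QuantumFieldTheory hiding SU2
open Summit.QuantumFields.YangMills.Theorems.FemtoTransferGap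
open Summit.QuantumFields.YangMills.Theorems.FemtoTransferGap.TT
open Summit.QuantumFields.YangMills.Theorems.VirialFluxGap.RingDeficit
open Summit.QuantumFields.YangMills.Theorems.SwapTwistDeficit.ToronLog (coneMeasure coneConst coneConst_pos isProbabilityMeasure_coneMeasure)
open Summit.QuantumFields.YangMills.Theorems.SwapVirialDeficit.SwapRing
open Summit.QuantumFields.YangMills.Theorems.SwapVirialDeficit.Gnomonic (gnomonicW gnomonicW_nonneg_le)

attribute [local instance] Literature.Analysis.FluidPDE.Tao2016.quatMeasurableSpace
  Literature.Analysis.FluidPDE.Tao2016.quatBorelSpace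
  Literature.MathematicalPhysics.QuantumLattice.secondCountableTopology_su2

namespace Summit.QuantumFields.YangMills.Theorems.SwapVirialDeficit.BlowUpRing

variable {L : ℕ} [NeZero L]

/-! ## §1 The leaders' weight `W_L` and the split of the weight functional -/

omit [NeZero L] in
/-- `0 ≤ W_L ≤ 12`. [folklore] -/
theorem leadersW_nonneg_le (η : GnoCoord L) :
    0 ≤ gnoWtr η.1.1 + gnoWtr η.1.2 + gnomonicW η.2.1 ∧ gnoWtr η.1.1 + gnoWtr η.1.2 + gnomonicW η.2.1 ≤ 12 := by
  have h1 := gnoWtr_nonneg_le η.1.1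
  have h2 := gnoWtr_nonneg_le η.1.2
  have h3 := gnomonicW_nonneg_le η.2.1
  constructor <;> linarith [h1.1, h1.2, h2.1, h2.2, h3.1, h3.2]

omit [NeZero L] in
/-- `W_L` is measurable. [folklore] -/
theorem measurable_leadersW : Measurable fun η : GnoCoord L => gnoWtr η.1.1 + gnoWtr η.1.2 + gnomonicW η.2.1 :=
  ((continuous_gnoWtr.measurable.comp (measurable_fst.comp measurable_fst)).add
    (continuous_gnoWtr.measurable.comp (measurable_snd.comp measurable_fst))).add
    (continuous_gnomonicW.measurable.comp (measurable_fst.comp measurable_snd))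

section Split

variable (z : Fin 3 → Bool) (a : ℍ) (ε : GnoSign L) {b : ℝ}

/-- The leaders' weight fibre integrand is integrable. [folklore] -/
theorem integrable_leadersW_fibre (hb : 0 ≤ b) :
    Integrable fun η : GnoCoord L => (gnoWtr η.1.1 + gnoWtr η.1.2 + gnomonicW η.2.1) * Real.exp (-(b * gnoDeficit z (fun _ => 1) a ε η)) * gnoDensity η := by
  refine (integrable_gnoDensity.const_mul 12).mono'
    ((measurable_leadersW.mul (((measurable_gnoDeficit z _ a ε).const_mul b).neg.exp)).mul measurable_gnoDensity).aestronglyMeasurable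
    (ae_of_all _ fun η => ?_)
  obtain ⟨h0, h12⟩ := leadersW_nonneg_le η
  rw [Real.norm_eq_abs, abs_mul, abs_mul, abs_of_nonneg h0, abs_of_pos (gnoDensity_pos η)]
  have h1 := abs_exp_gnoDeficit_le_one z (fun _ => (1 : SU2)) a ε hb η
  calc (gnoWtr η.1.1 + gnoWtr η.1.2 + gnomonicW η.2.1) * |Real.exp (-(b * gnoDeficit z (fun _ => 1) a ε η))| * gnoDensity η
      ≤ 12 * 1 * gnoDensity η := mul_le_mul_of_nonneg_right (mul_le_mul h12 h1 (abs_nonneg _) (by norm_num)) (gnoDensity_pos η).le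
    _ = 12 * gnoDensity η := by rw [mul_one]

/-- Fibrewise split `∫ gnoW·e·ρ = ∫ W_L·e·ρ + ∫ W_F·e·ρ`. [folklore] -/
theorem fibre_gnoW_split (hb : 0 ≤ b) :
    ∫ η : GnoCoord L, gnoW η * Real.exp (-(b * gnoDeficit z (fun _ => 1) a ε η)) * gnoDensity η =
      (∫ η : GnoCoord L, (gnoWtr η.1.1 + gnoWtr η.1.2 + gnomonicW η.2.1) * Real.exp (-(b * gnoDeficit z (fun _ => 1) a ε η)) * gnoDensity η) +
        ∫ η : GnoCoord L, (∑ f, gnomonicW (η.2.2 f)) * Real.exp (-(b * gnoDeficit z (fun _ => 1) a ε η)) * gnoDensity η := by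
  rw [← integral_add (integrable_leadersW_fibre z a ε hb) (integrable_followersW_fibre a ε z hb)]
  refine integral_congr_ae (ae_of_all _ fun η => ?_)
  show gnoW η * Real.exp (-(b * gnoDeficit z (fun _ => 1) a ε η)) * gnoDensity η = _
  rw [gnoW_eq_leaders_add_followers]; ring

end Split

/-- The leaders' weight functional is cone-integrable. [folklore] -/
theorem integrable_fibre_leadersW (z : Fin 3 → Bool) {b : ℝ} (hb : 0 ≤ b) :
    Integrable (fun a : ℍ => ∑ ε : GnoSign L, ∫ η : GnoCoord L,
      (gnoWtr η.1.1 + gnoWtr η.1.2 + gnomonicW η.2.1) * Real.exp (-(b * gnoDeficit z (fun _ => 1) a ε η)) * gnoDensity η) coneMeasure :=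
  integrable_sum_fibre z (fun _ => 1) (g := fun _ p => gnoWtr p.2.1.1 + gnoWtr p.2.1.2 + gnomonicW p.2.2.1)
    (fun _ => (measurable_leadersW.comp measurable_snd).aemeasurable) (M := 12)
    (fun _ p => by obtain ⟨h0, h1⟩ := leadersW_nonneg_le p.2; rw [abs_of_nonneg h0]; exact h1) hb

/-- ★ The weight functional splits: `⟪gnoW⟫_{z,b} = ⟪W_L⟫_{z,b} + ⟪W_F⟫_{z,b}`. [folklore] -/
theorem weight_functional_split (z : Fin 3 → Bool) {b : ℝ} (hb : 0 ≤ b) :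
    ∫ a, (∑ ε : GnoSign L, ∫ η : GnoCoord L, gnoW η * Real.exp (-(b * gnoDeficit z (fun _ => 1) a ε η)) * gnoDensity η) ∂coneMeasure =
      (∫ a, (∑ ε : GnoSign L, ∫ η : GnoCoord L,
          (gnoWtr η.1.1 + gnoWtr η.1.2 + gnomonicW η.2.1) * Real.exp (-(b * gnoDeficit z (fun _ => 1) a ε η)) * gnoDensity η) ∂coneMeasure) +
        ∫ a, (∑ ε : GnoSign L, ∫ η : GnoCoord L,
          (∑ f, gnomonicW (η.2.2 f)) * Real.exp (-(b * gnoDeficit z (fun _ => 1) a ε η)) * gnoDensity η) ∂coneMeasure := by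
  rw [← integral_add (integrable_fibre_leadersW z hb) (integrable_fibre_followersW z hb)]
  refine integral_congr_ae (ae_of_all _ fun a => ?_)
  show (∑ ε : GnoSign L, ∫ η : GnoCoord L, gnoW η * Real.exp (-(b * gnoDeficit z (fun _ => 1) a ε η)) * gnoDensity η) =
    (∑ ε : GnoSign L, ∫ η : GnoCoord L,
        (gnoWtr η.1.1 + gnoWtr η.1.2 + gnomonicW η.2.1) * Real.exp (-(b * gnoDeficit z (fun _ => 1) a ε η)) * gnoDensity η) +
      ∑ ε : GnoSign L, ∫ η : GnoCoord L, (∑ f, gnomonicW (η.2.2 f)) * Real.exp (-(b * gnoDeficit z (fun _ => 1) a ε η)) * gnoDensity η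
  rw [← Finset.sum_add_distrib]
  exact Finset.sum_congr rfl fun ε _ => fibre_gnoW_split z a ε hb

/-! ## §2 Window arithmetic: the followers' share is eventually below `c/2` -/

/-- ★ On the window `L ≤ β^{1/56}` with `β ≥ max 1 (2C₀/c)²`, `C₀ = 13824·(18 + 2K)·5`: the followers' coefficient is `≤ c/2`. [folklore] -/
theorem followers_window_arith {K c β : ℝ} (hK : 0 ≤ K) (hc : 0 < c) (hβ : 1 ≤ β)
    (hβc : (2 * (13824 * (18 + 2 * K) * 5) / c) ^ 2 ≤ β) {L : ℕ} [NeZero L] (hL : (L : ℝ) ≤ β ^ (1 / 56 : ℝ)) :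
    13824 * (L : ℝ) ^ 10 * ((2 * (9 * (L : ℝ) ^ 4 - 1) * Real.log β + K * (L : ℝ) ^ 4 * (1 + Real.log L)) / β) ≤ c / 2 := by
  have hβ0 : 0 < β := by linarith
  have hL1 : (1 : ℝ) ≤ L := by exact_mod_cast NeZero.one_le
  have hlogβ : 0 ≤ Real.log β := Real.log_nonneg hβ
  have hlogL : 0 ≤ Real.log L := Real.log_nonneg hL1
  -- `L^{14} ≤ β^{1/4}`
  have hL14 : (L : ℝ) ^ 14 ≤ β ^ (1 / 4 : ℝ) := by
    have h1 : (L : ℝ) ^ 14 ≤ (β ^ (1 / 56 : ℝ)) ^ 14 := pow_le_pow_left₀ (by positivity) hL 14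
    have h2 : (β ^ (1 / 56 : ℝ)) ^ 14 = β ^ (1 / 4 : ℝ) := by rw [← Real.rpow_natCast, ← Real.rpow_mul hβ0.le]; norm_num
    rw [← h2]; exact h1
  -- `log L ≤ log β ≤ 4 β^{1/4}`
  have hlogLβ : Real.log L ≤ Real.log β := by
    have hLβ : (L : ℝ) ≤ β := hL.trans (by
      calc β ^ (1 / 56 : ℝ) ≤ β ^ (1 : ℝ) := Real.rpow_le_rpow_of_exponent_le hβ (by norm_num)
        _ = β := Real.rpow_one β)
    exact Real.log_le_log (by linarith) hLβ
  have hlog4 : Real.log β ≤ 4 * β ^ (1 / 4 : ℝ) := by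
    have h := Real.log_le_rpow_div hβ0.le (by norm_num : (0:ℝ) < 1 / 4)
    linarith [h]
  have hq0 : 0 < β ^ (1 / 4 : ℝ) := Real.rpow_pos_of_pos hβ0 _
  have hq1 : 1 ≤ β ^ (1 / 4 : ℝ) := Real.one_le_rpow hβ (by norm_num)
  -- numerator bound `≤ C₀ · β^{1/4} · β^{1/4}`
  have hnum : 13824 * (L : ℝ) ^ 10 * (2 * (9 * (L : ℝ) ^ 4 - 1) * Real.log β + K * (L : ℝ) ^ 4 * (1 + Real.log L)) ≤
      13824 * (18 + 2 * K) * 5 * (β ^ (1 / 4 : ℝ) * β ^ (1 / 4 : ℝ)) := by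
    have hL10 : (0 : ℝ) ≤ (L : ℝ) ^ 10 := by positivity
    have hL14n : (0 : ℝ) ≤ (L : ℝ) ^ 14 := by positivity
    have e14 : (L : ℝ) ^ 10 * (L : ℝ) ^ 4 = (L : ℝ) ^ 14 := by ring
    have e1 : (L : ℝ) ^ 10 * (2 * (9 * (L : ℝ) ^ 4 - 1) * Real.log β) ≤ 18 * (L : ℝ) ^ 14 * Real.log β := by
      nlinarith [mul_nonneg hL10 hlogβ]
    have e2 : (L : ℝ) ^ 10 * (K * (L : ℝ) ^ 4 * (1 + Real.log L)) ≤ K * (L : ℝ) ^ 14 * (1 + Real.log β) := by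
      rw [show (L : ℝ) ^ 10 * (K * (L : ℝ) ^ 4 * (1 + Real.log L)) = K * (L : ℝ) ^ 14 * (1 + Real.log L) by ring]
      exact mul_le_mul_of_nonneg_left (by linarith) (mul_nonneg hK hL14n)
    have e3 : 18 * (L : ℝ) ^ 14 * Real.log β ≤ 18 * β ^ (1 / 4 : ℝ) * (4 * β ^ (1 / 4 : ℝ)) :=
      mul_le_mul (mul_le_mul_of_nonneg_left hL14 (by norm_num)) hlog4 hlogβ (by positivity)
    have e4 : K * (L : ℝ) ^ 14 * (1 + Real.log β) ≤ K * β ^ (1 / 4 : ℝ) * (5 * β ^ (1 / 4 : ℝ)) :=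
      mul_le_mul (mul_le_mul_of_nonneg_left hL14 hK) (by linarith) (by linarith) (by positivity)
    nlinarith [e1, e2, e3, e4, hq0]
  have hββ : β ^ (1 / 4 : ℝ) * β ^ (1 / 4 : ℝ) = Real.sqrt β := by
    rw [← Real.rpow_add hβ0, Real.sqrt_eq_rpow]; norm_num
  rw [hββ] at hnum
  -- `C₀ √β / β = C₀ / √β ≤ c/2`
  have hsqrt0 : 0 < Real.sqrt β := Real.sqrt_pos.2 hβ0
  have hC0 : 0 < 13824 * (18 + 2 * K) * 5 := by positivity
  have hsq : 2 * (13824 * (18 + 2 * K) * 5) / c ≤ Real.sqrt β := by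
    rw [← Real.sqrt_sq (by positivity : (0:ℝ) ≤ 2 * (13824 * (18 + 2 * K) * 5) / c)]
    exact Real.sqrt_le_sqrt hβc
  rw [div_le_iff₀ hc] at hsq
  calc 13824 * (L : ℝ) ^ 10 * ((2 * (9 * (L : ℝ) ^ 4 - 1) * Real.log β + K * (L : ℝ) ^ 4 * (1 + Real.log L)) / β)
      = 13824 * (L : ℝ) ^ 10 * (2 * (9 * (L : ℝ) ^ 4 - 1) * Real.log β + K * (L : ℝ) ^ 4 * (1 + Real.log L)) / β := by ring
    _ ≤ 13824 * (18 + 2 * K) * 5 * Real.sqrt β / β := div_le_div_of_nonneg_right hnum hβ0.le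
    _ = 13824 * (18 + 2 * K) * 5 / Real.sqrt β := by
        rw [div_eq_div_iff hβ0.ne' hsqrt0.ne']
        nlinarith [Real.mul_self_sqrt hβ0.le]
    _ ≤ c / 2 := by
        rw [div_le_iff₀ hsqrt0]
        nlinarith [hsq]

/-! ## §3 Principal-sector window stiffness from the leaders' window inequality -/

/-- ★★★ **PRINCIPAL-SECTOR WINDOW STIFFNESS FROM THE LEADERS' WINDOW INEQUALITY** (followers absorbed, uniformly in `L`).  Hypothesis (LW), inline:
there are `a > 0`, `c > 0`, `β₀`, `L₀` such that for `β ≥ β₀`, `L₀ ≤ L ≤ β^a`,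
`K_L·(½⟪W_L⟫_{0,β} − β⟪R⟫_{0,β}) ≤ (1/2 − c)·Z₀(β)`, with the LEADERS' weight `W_L = gnoWtr(x) + gnoWtr(y) + gnomonicW(z)` (three letters) in place of
`gnoW`.  Conclusion (the `z = 000` half of (TS) of ✓`swapGluedStiffness_of_twoSectorStiffness`): with `a' = min a (1/56)`, `c' = c/2`, an explicit `β₀'`, same `L₀`,
`(9L⁴ − 3/2 + c')·Z₀(β) ≤ β·E₀(β)` on the window (✓`virial_ring'`, `weight_functional_split`, ✓`followersW_term_apriori`, `followers_window_arith`).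
(LW) is OPEN — it is the valley term of the four leader letters plus the remainder; this is a reduction. [cite: tHooft1979] [cite: Luscher1983, §2] -/
theorem principalStiffness_of_leadersWindow
    (hLW : ∃ a : ℝ, 0 < a ∧ ∃ c : ℝ, 0 < c ∧ ∃ β₀ : ℝ, ∃ L₀ : ℕ, ∀ β : ℝ, β₀ ≤ β → ∀ (L : ℕ) [NeZero L], L₀ ≤ L → (L : ℝ) ≤ β ^ a →
      (coneConst ^ 3 / 64 * (1 / (2 * Real.pi ^ 2)) ^ Fintype.card (Fol L)) *
          (1 / 2 * (∫ a, (∑ ε : GnoSign L, ∫ η : GnoCoord L,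
              (gnoWtr η.1.1 + gnoWtr η.1.2 + gnomonicW η.2.1) * Real.exp (-(β * gnoDeficit (fun _ => false) (fun _ => 1) a ε η)) * gnoDensity η) ∂coneMeasure)
            - β * (∫ a, (∑ ε : GnoSign L, ∫ η : GnoCoord L,
              (gnoDeficit (fun _ => false) (fun _ => 1) a ε η - gnoXDeficit (fun _ => false) (fun _ => 1) a ε η / 2) *
                Real.exp (-(β * gnoDeficit (fun _ => false) (fun _ => 1) a ε η)) * gnoDensity η) ∂coneMeasure)) ≤
        (1 / 2 - c) * ∫ p, Real.exp (-(β * swapRingDeficit L (fun _ => false) p)) ∂(ringMeasure L)) :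
    ∃ a : ℝ, 0 < a ∧ ∃ c : ℝ, 0 < c ∧ ∃ β₀ : ℝ, ∃ L₀ : ℕ, ∀ β : ℝ, β₀ ≤ β → ∀ (L : ℕ) [NeZero L], L₀ ≤ L → (L : ℝ) ≤ β ^ a →
      (9 * (L : ℝ) ^ 4 - 3 / 2 + c) * ∫ P, Real.exp (-(β * swapRingDeficit L (fun _ => false) P)) ∂(ringMeasure L) ≤
        β * ∫ P, swapRingDeficit L (fun _ => false) P * Real.exp (-(β * swapRingDeficit L (fun _ => false) P)) ∂(ringMeasure L) := by
  obtain ⟨a, ha, c, hc, β₀, L₀, hLW⟩ := hLW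
  obtain ⟨K, hK, β₁, hβ₁, hF⟩ := followersW_term_apriori
  refine ⟨min a (1 / 56), lt_min ha (by norm_num), c / 2, by linarith, max β₀ (max β₁ (max 1 ((2 * (13824 * (18 + 2 * K) * 5) / c) ^ 2))), L₀,
    fun β hβ L _ hL hLβ => ?_⟩
  have hβ₀ : β₀ ≤ β := (le_max_left _ _).trans hβ
  have hββ₁ : β₁ ≤ β := (le_max_left _ _).trans ((le_max_right _ _).trans hβ)
  have hβ1 : (1 : ℝ) ≤ β := (le_max_left _ _).trans ((le_max_right _ _).trans ((le_max_right _ _).trans hβ))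
  have hβc : (2 * (13824 * (18 + 2 * K) * 5) / c) ^ 2 ≤ β := (le_max_right _ _).trans ((le_max_right _ _).trans ((le_max_right _ _).trans hβ))
  have hβpos : 0 < β := lt_of_lt_of_le one_pos hβ1
  have hLa : (L : ℝ) ≤ β ^ a := hLβ.trans (Real.rpow_le_rpow_of_exponent_le hβ1 (min_le_left _ _))
  have hL56 : (L : ℝ) ≤ β ^ (1 / 56 : ℝ) := hLβ.trans (Real.rpow_le_rpow_of_exponent_le hβ1 (min_le_right _ _))
  have h1 := hLW β hβ₀ L hL hLa
  have h2 := hF L β hββ₁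
  have h3 := followers_window_arith hK hc hβ1 hβc hL56
  have hV := virial_ring' (L := L) (fun _ => false) hβpos
  rw [half_two_alpha_eq, weight_functional_split (fun _ => false) hβpos.le] at hV
  have hZ : 0 ≤ ∫ P, Real.exp (-(β * swapRingDeficit L (fun _ => false) P)) ∂(ringMeasure L) := integral_nonneg fun P => (Real.exp_pos _).le
  -- followers' share `≤ (c/2)·Z₀`
  have h4 : 1 / 2 * ((coneConst ^ 3 / 64 * (1 / (2 * Real.pi ^ 2)) ^ Fintype.card (Fol L)) *
      ∫ a, (∑ ε : GnoSign L, ∫ η : GnoCoord L,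
        (∑ f, gnomonicW (η.2.2 f)) * Real.exp (-(β * gnoDeficit (fun _ => false) (fun _ => 1) a ε η)) * gnoDensity η) ∂coneMeasure) ≤
      c / 2 * ∫ p, Real.exp (-(β * swapRingDeficit L (fun _ => false) p)) ∂(ringMeasure L) :=
    h2.trans (mul_le_mul_of_nonneg_right h3 hZ)
  nlinarith [h1, h4, hV]

end Summit.QuantumFields.YangMills.Theorems.SwapVirialDeficit.BlowUpRing

end
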